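import Summits.AtomisticToContinuum.Crystallization.Theorems.ThreeConeCertificateExactCertificateAsymptoticKernel
import Summits.AtomisticToContinuum.Crystallization.Theorems.ThreeConeCertificateExactCertificateAsymptoticSplit

/-!
# `ExactCertificate` (stmt-AtomisticToContinuum-11959): the three-cone programme has NO
# ASYMPTOTIC DUALITY GAP, III — the value over all finite ranges is exactly `−e*`

Line `closure-makes-nogap-exact`, continuation lead c2 (registered stubs `stub_asymptoticNoGap`,
`stub_existsSplit` of the crux item; part I = `…AsymptoticKernel` (c1, p107933: the cheap Bochner cones
`f_ρ = (135/ρ³)e^{−d²} − 5∫₀^{9/ρ²} u²e^{−ud²}du`), part II = `…AsymptoticSplit` (kernel-agnostic: such a cone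
yields a range-`ρ` split of value `≤ −e* + K/ρ`)).

* `stub_asymptoticNoGap` — for every `ε > 0` there is a finite-range three-cone split `(ρ, c, g, U, f)` of
  `V_LJ` (`IsSplit ρ c g U f`) with `c + f 0/2 ≤ −e* + ε` (`ρ = max 1000 (K/ε)`).
* `value_sandwich` — with the floor `IsSplit.value_ge` (no split beats `−e*`): the value of the three-cone
  programme over all finite ranges is EXACTLY `−e*`.  Consequently the crux's content `SharpSplit` (= the line's
  `stub_noGap`) is precisely the ATTAINMENT of that infimum at a finite range — finite-range exactness — and
  `ExactCertificate` = (finite-range exactness) ∧ (attainment of `e*` by a periodic configuration, item 11961).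
* `stub_existsSplit` — a STABLE split exists (`ε = 1`): with `Feasible.stub_withoutStability` the load-bearing
  table of the crux is complete ((S5) or (S6) dropped ⇒ true; (S3) dropped ⇔ KeplerBound; (S1)/(S2)/(S4) dropped
  ⇒ trivial).

All `[folklore]`.
-/

noncomputable section

namespace Summit.AtomisticToContinuum.Crystallization.Theorems.ThreeConeCertificateExactCertificate.Asymptotic

open Literature.MathematicalPhysics.StatisticalMechanics
open Summit.AtomisticToContinuum.Crystallization.Theorems.ChargedEnergyGapNegative (eStar)
open Summit.AtomisticToContinuum.Crystallization.Theorems.ExactCertificateNegative (IsSplit)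
open scoped BigOperators

/-- **Registered stub `stub_asymptoticNoGap` of crux item stmt-AtomisticToContinuum-11959 (line
`closure-makes-nogap-exact`; signature verbatim): ASYMPTOTIC NO-GAP — for every `ε > 0` there is a finite-range
three-cone split of `V_LJ` of value `c + f 0/2 ≤ −e* + ε`.**  Take `ρ = max 1000 (K/ε)` and the cheap Bochner
cone `f_ρ` of part I (`stub_asymptoticKernel`, `nonpos_of_le`) in part II's `stub_splitOfKernel`. [folklore] -/
theorem stub_asymptoticNoGap : ∀ ε : ℝ, 0 < ε → ∃ (ρ c : ℝ) (g U f : ℝ → ℝ),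
    Summit.AtomisticToContinuum.Crystallization.Theorems.ExactCertificateNegative.IsSplit ρ c g U f ∧
      c + f 0 / 2 ≤ -Summit.AtomisticToContinuum.Crystallization.Theorems.ChargedEnergyGapNegative.eStar + ε := by
  intro ε hε
  set K : ℝ := 8 * 810 * (65536 ^ 2 / 12) + 135 with hK
  set ρ : ℝ := max 1000 (K / ε) with hρdef
  have hρ : 1000 ≤ ρ := le_max_left _ _
  have hρ0 : 0 < ρ := lt_of_lt_of_le (by norm_num) hρ
  have hKρ : K / ρ ≤ ε := by
    rw [div_le_iff₀ hρ0]
    have h1 : K / ε ≤ ρ := le_max_right _ _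
    rw [div_le_iff₀ hε] at h1
    linarith [mul_comm ε ρ]
  have hρ3 : (3 : ℝ) ≤ ρ := le_trans (by norm_num) hρ
  -- the kernel of part I at range `ρ`
  set f : ℝ → ℝ := fun d => 135 / ρ ^ 3 * Real.exp (-1 * d ^ 2) -
    5 * ∫ u in (0 : ℝ)..(9 / ρ ^ 2), u ^ 2 * Real.exp (-u * d ^ 2) with hf
  have hpd : ∀ (n : ℕ) (y : Fin n → EuclideanSpace ℝ (Fin 3)) (w : Fin n → ℝ),
      0 ≤ ∑ i, ∑ j, w i * w j * f (dist (y i) (y j)) := posType hρ3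
  have h0 : f 0 ≤ 135 / ρ ^ 3 := (apply_zero_le hρ3).2
  have hneg : ∀ d : ℝ, Real.sqrt (Real.sqrt ρ) ≤ d → d ≤ ρ → f d ≤ 0 :=
    fun d hd1 hd2 => nonpos_of_le hρ hd1 hd2
  have htail : ∀ d : ℝ, ρ ≤ d → f d ≤ lennardJones d := fun d hd => le_lennardJones hρ hd
  obtain ⟨c, g, U, hs, hv⟩ := stub_splitOfKernel ρ f hρ hpd h0 hneg htail
  exact ⟨ρ, c, g, U, f, hs, hv.trans (by linarith)⟩

/-- **The value of the three-cone programme over all finite ranges is EXACTLY `−e*`**: for every `ε > 0` some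
finite-range split has `−e* ≤ c + f 0/2 ≤ −e* + ε` (floor `IsSplit.value_ge` + `stub_asymptoticNoGap`).  So
`SharpSplit`/`stub_noGap` asks precisely for ATTAINMENT at a finite range. [folklore] -/
theorem value_sandwich {ε : ℝ} (hε : 0 < ε) : ∃ (ρ c : ℝ) (g U f : ℝ → ℝ),
    IsSplit ρ c g U f ∧ -eStar ≤ c + f 0 / 2 ∧ c + f 0 / 2 ≤ -eStar + ε := by
  obtain ⟨ρ, c, g, U, f, h, hv⟩ := stub_asymptoticNoGap ε hε
  exact ⟨ρ, c, g, U, f, h, h.value_ge, hv⟩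

/-- The infimum form: **no level strictly above `−e*` is a lower bound of the split values** — for every real
`v` with `−e* < v` some finite-range split has value `< v`. [folklore] -/
theorem exists_split_value_lt {v : ℝ} (hv : -eStar < v) : ∃ (ρ c : ℝ) (g U f : ℝ → ℝ),
    IsSplit ρ c g U f ∧ c + f 0 / 2 < v := by
  obtain ⟨ρ, c, g, U, f, h, -, hle⟩ := value_sandwich (show 0 < (v + eStar) / 2 by linarith)
  exact ⟨ρ, c, g, U, f, h, by linarith⟩

/-- **Registered stub `stub_existsSplit` of crux item stmt-AtomisticToContinuum-11959 (signature verbatim): a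
STABLE three-cone split of `V_LJ` exists** — so the crux with the value equation (S6) dropped holds; together
with `Feasible.stub_withoutStability` ((S5) dropped ⇒ the crux holds for every template) the load-bearing table
is complete: finite range (S3), stability (S5) and the value equation (S6) jointly carry the whole content.
[folklore] -/
theorem stub_existsSplit : ∃ (ρ c : ℝ) (g U f : ℝ → ℝ),
    Summit.AtomisticToContinuum.Crystallization.Theorems.ExactCertificateNegative.IsSplit ρ c g U f := by
  obtain ⟨ρ, c, g, U, f, h, -⟩ := stub_asymptoticNoGap 1 one_pos
  exact ⟨ρ, c, g, U, f, h⟩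

end Summit.AtomisticToContinuum.Crystallization.Theorems.ThreeConeCertificateExactCertificate.Asymptotic

end
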